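/-
rh-inputs cell (A1 = `Grosswald1967_thmB`), prover-3, 2026-08-28.  Assembly: the named fact
`Grosswald1967_thmB` (Pólya's sign-change theorem, Grosswald 1967 Thm B) is DISCHARGED from the two
pieces of the A1 architecture.  Nothing in this file bears on the truth of RH.
-/
import Literature.NumberTheory.LFunctions.PolyaSignChangesCounting
import Literature.NumberTheory.LFunctions.PolyaSignChangesInfiniteHeight

/-!
# `Grosswald1967_thmB` holds (assembly of the moment-method proof)

`Grosswald1967_thmB_holds : Grosswald1967_thmB` — the named fact of
`Literature/NumberTheory/LFunctions/PolyaSignChanges.lean` (Pólya 1930 Satz III / Grosswald, TAMS 126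
(1967), §4 Theorem B / Steinig 1969 for `γ = +∞`: `limsup W(y)/log y ≥ Γ/π` for the sign changes of a
real `g` whose Mellin transform continues meromorphically past its abscissa of holomorphy `θ` with a
pole-free box of half-height `Γ` around `θ`) is PROVED, by the composition
`grosswald1967_thmB_of : PieceA → PieceB → Grosswald1967_thmB` (`PolyaSignChangesMomentDefs`) of

* `pieceA` (`PolyaSignChangesCounting`, the Descartes–Laguerre moment-method counting lemma:
  admissible pole-pair data at a real point `λ` force sign-chain density `≥ λ·arctan(γ/(λ−β))/(πx)`;
  inputs `laguerre_truncatedMoments` (`PolyaSignChangesLaguerre`), the pole-pair Taylor asymptotics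
  (`PolyaSignChangesPolePair`), the tail estimate and the block counting), and
* `pieceB` (`PolyaSignChangesInfiniteHeight`, pole bookkeeping: under the hypotheses of Theorem B,
  admissible data with rate `≥ Γ − ε` exist for every `ε > 0` — nearest pole of the meromorphic normal
  form to a large generic `λ`, real symmetrisation; covers `P ≠ ∅` and Pólya's gap case `P = ∅`
  uniformly).

The architecture is the cell's own (by report the method of Kaczorowski, Acta Arith. 45 (1985));
the printed proofs (Pólya 1930, Steinig 1969) were not ported.  Consequence for the tree: every user of
the hypothesis `(h : Grosswald1967_thmB)` — in particular
`Summit.RiemannHypothesis.RiemannHypothesis.Theorems.polyaLandauR_of_grosswald1967` — becomes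
unconditional.
-/

noncomputable section

namespace Literature.NumberTheory.LFunctions

namespace PolyaSignChanges

/-- **Pólya's sign-change theorem (Grosswald 1967, Theorem B) holds**: the named fact
`Grosswald1967_thmB` is discharged by the moment-method pieces `pieceA` (counting) and `pieceB`
(infinite height / pole bookkeeping) through `grosswald1967_thmB_of`.
[cite: Grosswald1967, §4 Theorem B (Pólya), pp. 4–5; Polya1930; Steinig1969] -/
theorem Grosswald1967_thmB_holds : Grosswald1967_thmB :=
  grosswald1967_thmB_of pieceA pieceB

end PolyaSignChanges

end Literature.NumberTheory.LFunctions

end
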